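import Mathlib
import Summits.Ventures.PercRepro2.V2SP
import Summits.Ventures.PercRepro2.Tail2DTailAvg
import Summits.Ventures.PercRepro2.Tail2DLeafPar
import Summits.Ventures.PercRepro2.Tail2DSP
import Summits.Ventures.PercRepro2.Tail2DStochDom
import Summits.Ventures.PercRepro2.HallOffFrame

/-!
# (SD) is unconditional on every leaf-parallel pattern
(seat mine-b, cell pub-perc-repro2; conjectures/MINE-B.md §41.6)

The one-edge parallel step of the stochastic domination (SD) (`Tail2DStochDom.sdomZ_par_free`) needs the
anti-diagonal log-concavity `T(u,v−1)·T(u−2,v+1) ≤ T(u−1,v)²` of the clipped tails of the smaller pattern.  The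
lane's tail calculus supplies it: the clipped real tail `clipTail s (a,b) = T(a⁺,b⁺)` of a leaf-parallel pattern
is an M♮-concave tail in the sense of `Tail2D.IsMTail` — the atoms are the point mass `pt` (absent) and the
single-edge convolution `bconv w11 1 pt` (free), a series composition multiplies the tails (`IsMTail.mul`) and a
parallel composition with a free edge is the convolution `bconv w11 1` with the log-concave weights `(1,1)`
(`bconv_isMTail`, the bundle step with `c = 1`) — and `IsMTail.antidiag` is exactly `TailLC`.  Hence
**(SD) at every clipped position on every leaf-parallel pattern** (`sdomZ_of_leafPar`), unconditionally, and
in particular the normalized-matching form of the anti-diagonal unimodality of the tails for every monotone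
weight (`sdom_of_leafPar`, `upperSet_tail_le_of_leafPar`).  With the count inequality of the class
(`offaxis_of_leafPar`, and the colour swap on the diagonal) this is the HALL / MONOTONE-RELAY form of EVERY member
`(a, j)`, `j + 1 ≤ a`, on every leaf-parallel pattern (`hallFn_phi_of_sdomZ`, `hallFn_phi_of_leafPar`): an injection
from `{r ≥ a, b = j}` into `{r = a−1, b ≥ j+1}` that only recolours red edges blue (`HallOffFrame.HallFn`).
-/

namespace Summit.Ventures.PercRepro2.Tail2D

open V2Closure

section ClipTail

/-- the clipped real tail `T(a⁺, b⁺)` of a pattern -/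
noncomputable def clipTail (s : V2Closure.SP) (a b : ℤ) : ℝ := (tailCount s a.toNat b.toNat : ℝ)

/-- the clipped tail of an absent edge is the point mass -/
theorem clipTail_absent : clipTail V2Closure.SP.absent = pt := by
  funext a b
  unfold clipTail pt tailCount
  rw [Finset.card_filter, sum_absent_conf]
  simp only [SP.rLab, SP.bLab]
  split_ifs <;> first | (exfalso; omega) | simp

/-- the clipped tail of a free edge is the single-edge convolution of the point mass -/
theorem clipTail_free : clipTail V2Closure.SP.free = bconv w11 1 pt := by
  funext a b
  rw [bconv_w11]
  unfold clipTail pt tailCount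
  rw [Finset.card_filter, sum_free_conf]
  simp only [SP.rLab, SP.bLab]
  simp only [Bool.false_eq_true, ↓reduceIte, nonpos_iff_eq_zero]
  split_ifs <;> (try norm_num) <;> omega

/-- the clipped tail of a series composition is the product of the clipped tails -/
theorem clipTail_ser (s t : V2Closure.SP) :
    clipTail (V2Closure.SP.ser s t) = fun a b => clipTail s a b * clipTail t a b := by
  funext a b
  unfold clipTail
  rw [tailCount_ser]
  push_cast
  rfl

/-- the clipped tail of `s ∥ e` is the single-edge convolution of the clipped tail of `s` -/
theorem clipTail_par_free (s : V2Closure.SP) :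
    clipTail (V2Closure.SP.par s V2Closure.SP.free) = bconv w11 1 (clipTail s) := by
  funext a b
  rw [bconv_w11]
  unfold clipTail
  rw [tailCount_par_free]
  have e1 : a.toNat - 1 = (a - 1).toNat := by omega
  have e2 : b.toNat - 1 = (b - 1).toNat := by omega
  rw [e1, e2]
  push_cast
  ring

/-- the clipped tail of `e ∥ s` is the single-edge convolution of the clipped tail of `s` -/
theorem clipTail_free_par (s : V2Closure.SP) :
    clipTail (V2Closure.SP.par V2Closure.SP.free s) = bconv w11 1 (clipTail s) := by
  funext a b
  rw [bconv_w11]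
  unfold clipTail
  rw [tailCount_free_par]
  have e1 : a.toNat - 1 = (a - 1).toNat := by omega
  have e2 : b.toNat - 1 = (b - 1).toNat := by omega
  rw [e1, e2]
  push_cast
  ring

/-- **the clipped tail of every leaf-parallel pattern is an M♮-concave tail** (the lane's (TAIL-M♮) on the
class: atoms, the series step `IsMTail.mul`, the bundle step `bconv_isMTail` with one free edge) -/
theorem leafPar_isMTail : ∀ {s : V2Closure.SP}, LeafPar s → ∃ L : ℤ, IsMTail (clipTail s) L
  | _, .free => ⟨0 + 1, by rw [clipTail_free]; exact bconv_isMTail pt_isMTail w11_isLCW (by norm_num)⟩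
  | _, .absent => ⟨0, by rw [clipTail_absent]; exact pt_isMTail⟩
  | _, .ser hs ht => by
      obtain ⟨L, hL⟩ := leafPar_isMTail hs
      obtain ⟨M, hM⟩ := leafPar_isMTail ht
      exact ⟨min L M, by rw [clipTail_ser]; exact IsMTail.mul hL hM⟩
  | _, .parFree hs => by
      obtain ⟨L, hL⟩ := leafPar_isMTail hs
      exact ⟨L + 1, by rw [clipTail_par_free]; exact bconv_isMTail hL w11_isLCW (by norm_num)⟩
  | _, .freePar hs => by
      obtain ⟨L, hL⟩ := leafPar_isMTail hs
      exact ⟨L + 1, by rw [clipTail_free_par]; exact bconv_isMTail hL w11_isLCW (by norm_num)⟩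

/-- the anti-diagonal log-concavity of an M♮-concave clipped tail, in the form used by the parallel step -/
theorem tailLC_of_isMTail {s : V2Closure.SP} {L : ℤ} (hT : IsMTail (clipTail s) L) (u v : ℤ) :
    TailLC s u v := by
  have h := hT.antidiag (u - 1) v
  have e1 : u - 1 + 1 = u := by ring
  have e2 : u - 1 - 1 = u - 2 := by ring
  rw [e1, e2] at h
  unfold clipTail at h
  unfold TailLC
  exact_mod_cast h

/-- **the tails of every leaf-parallel pattern are anti-diagonally log-concave** -/
theorem tailLC_of_leafPar {s : V2Closure.SP} (hs : LeafPar s) (u v : ℤ) : TailLC s u v := by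
  obtain ⟨L, hL⟩ := leafPar_isMTail hs
  exact tailLC_of_isMTail hL u v

end ClipTail

section Unconditional

/-- **(SD) at every clipped position on every leaf-parallel pattern**, unconditionally -/
theorem sdomZ_of_leafPar {s : V2Closure.SP} (hs : LeafPar s) (u v : ℤ) : SDomZ s u v :=
  sdomZ_leafPar (fun _ ht u v => tailLC_of_leafPar ht u v) hs u v

/-- **(SD) on every leaf-parallel pattern in `ℕ`-positions**: for every monotone weight `f` and every `a, c`,
`Σ_f(a,c) · T(a−1,c+1) ≤ Σ_f(a−1,c+1) · T(a,c)` — the average of `f` over the tail `{r ≥ a, b ≥ c}` does not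
decrease when the tail moves one step bluer -/
theorem sdom_of_leafPar {s : V2Closure.SP} (hs : LeafPar s) (a c : ℕ) (f : s.Conf → ℕ) (hf : Monotone f) :
    tailSum s f a c * tailCount s (a - 1) (c + 1) ≤ tailSum s f (a - 1) (c + 1) * tailCount s a c := by
  have key := sdomZ_of_leafPar hs a c f hf
  have e1 : ((a : ℤ)).toNat = a := by omega
  have e2 : ((a : ℤ) - 1).toNat = a - 1 := by omega
  have e3 : ((c : ℤ)).toNat = c := by omega
  have e4 : ((c : ℤ) + 1).toNat = c + 1 := by omega
  rw [e1, e2, e3, e4] at key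
  exact key

/-- the normalized-matching form on every leaf-parallel pattern: for every upper set `U` (an increasing event),
`#(U ∩ E(a,c)) · T(a−1,c+1) ≤ #(U ∩ E(a−1,c+1)) · T(a,c)` -/
theorem upperSet_tail_le_of_leafPar {s : V2Closure.SP} (hs : LeafPar s) (a c : ℕ) (U : Finset s.Conf)
    (hU : ∀ x y : s.Conf, x ≤ y → x ∈ U → y ∈ U) :
    (tailSet s a c ∩ U).card * tailCount s (a - 1) (c + 1)
      ≤ (tailSet s (a - 1) (c + 1) ∩ U).card * tailCount s a c := by
  have hf : Monotone (fun x : s.Conf => if x ∈ U then 1 else 0) := by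
    intro x y hxy
    by_cases hx : x ∈ U
    · simp [hx, hU x y hxy hx]
    · simp [hx]
  have key := sdom_of_leafPar hs a c _ hf
  have e : ∀ a' c', tailSum s (fun x => if x ∈ U then 1 else 0) a' c' = (tailSet s a' c' ∩ U).card := by
    intro a' c'
    simp [tailSum]
  rw [e, e] at key
  exact key

end Unconditional

section Hall

/-- the `phi`-mass of an upper set is the difference of its tail counts at `(a−1, j+1)` and `(a, j)`
(the common part `{r ≥ a, b ≥ j+1}` cancels) -/
theorem sum_phi_eq_sub {s : V2Closure.SP} (a j : ℕ) (ha : 1 ≤ a) (V : Finset s.Conf) :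
    ∑ x ∈ V, phi a j (s.rLab x) (s.bLab x)
      = ((tailSet s (a - 1) (j + 1) ∩ V).card : ℤ) - ((tailSet s a j ∩ V).card : ℤ) := by
  have e : ∀ x : s.Conf, phi a j (s.rLab x) (s.bLab x)
      = ((if x ∈ tailSet s (a - 1) (j + 1) then 1 else 0) : ℤ) - (if x ∈ tailSet s a j then 1 else 0) := by
    intro x
    unfold phi tailSet
    simp only [Finset.mem_filter, Finset.mem_univ, true_and]
    have key : ((if s.rLab x + 1 = a ∧ j + 1 ≤ s.bLab x then 1 else 0) : ℤ)
        - (if a ≤ s.rLab x ∧ s.bLab x = j then 1 else 0)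
        = ((if a - 1 ≤ s.rLab x ∧ j + 1 ≤ s.bLab x then 1 else 0) : ℤ)
          - (if a ≤ s.rLab x ∧ j ≤ s.bLab x then 1 else 0) := by
      split_ifs <;> omega
    exact key
  simp only [e, Finset.sum_sub_distrib, Finset.sum_boole]
  rw [Finset.filter_mem_eq_inter, Finset.filter_mem_eq_inter, Finset.inter_comm, Finset.inter_comm V]

/-- **(SD) and the count inequality give the Hall form**: if the uniform measure on `E(a,j)` is dominated by the
one on `E(a−1,j+1)` and `T(a,j) ≤ T(a−1,j+1)`, then every upper set carries non-negative `phi a j`-mass, i.e.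
(Hall) there is an injection `{r ≥ a, b = j} → {r = a−1, b ≥ j+1}` recolouring red edges blue -/
theorem hallFn_phi_of_sdomZ {s : V2Closure.SP} (a j : ℕ) (ha : 1 ≤ a) (hSD : SDomZ s a j)
    (hT : tailCount s a j ≤ tailCount s (a - 1) (j + 1)) : HallFn (phi a j) s.rLab s.bLab := by
  intro V hV
  rw [sum_phi_eq_sub a j ha V]
  have hf : Monotone (fun x : s.Conf => if x ∈ V then 1 else 0) := by
    intro x y hxy
    by_cases hx : x ∈ V
    · have hy : y ∈ V := hV hxy hx
      simp [hx, hy]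
    · simp [hx]
  have key := hSD _ hf
  have e1 : ((a : ℤ)).toNat = a := by omega
  have e2 : ((a : ℤ) - 1).toNat = a - 1 := by omega
  have e3 : ((j : ℤ)).toNat = j := by omega
  have e4 : ((j : ℤ) + 1).toNat = j + 1 := by omega
  rw [e1, e2, e3, e4] at key
  have e : ∀ a' c', tailSum s (fun x => if x ∈ V then 1 else 0) a' c' = (tailSet s a' c' ∩ V).card := by
    intro a' c'
    simp [tailSum]
  rw [e, e] at key
  -- `N·T′ ≤ N′·T` and `T ≤ T′` give `N ≤ N′` (if `T′ = 0` both tails are empty)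
  set N := (tailSet s a j ∩ V).card
  set N' := (tailSet s (a - 1) (j + 1) ∩ V).card
  set T := tailCount s a j
  set T' := tailCount s (a - 1) (j + 1)
  have hNN : N ≤ N' := by
    rcases Nat.eq_zero_or_pos T' with h0 | hpos
    · have hT0 : T = 0 := by omega
      have hN0 : N = 0 := by
        have : N ≤ T := Finset.card_le_card (Finset.inter_subset_left)
        omega
      omega
    · have : N * T' ≤ N' * T' := le_trans key (Nat.mul_le_mul_left _ hT)
      exact Nat.le_of_mul_le_mul_right this hpos
  omega

/-- **the Hall / monotone-relay form of every member of the family on every leaf-parallel pattern**: for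
`j + 1 ≤ a` there is an injection from `{r ≥ a, b = j}` into `{r = a−1, b ≥ j+1}` that only recolours red edges
blue (`HallFn (phi a j)`); the count inequality is `offaxis_of_leafPar` for `j + 2 ≤ a` and the colour swap
on the diagonal `a = j + 1` -/
theorem hallFn_phi_of_leafPar {s : V2Closure.SP} (hs : LeafPar s) (a j : ℕ) (hja : j + 1 ≤ a) :
    HallFn (phi a j) s.rLab s.bLab := by
  refine hallFn_phi_of_sdomZ a j (by omega) (sdomZ_of_leafPar hs a j) ?_
  rcases (by omega : j + 2 ≤ a ∨ a = j + 1) with h | h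
  · exact offaxis_of_leafPar hs a j h
  · subst h
    rw [tailCount_symm]
    simp

end Hall

end Summit.Ventures.PercRepro2.Tail2D
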